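import Summits.ABC.ABC.Theorems.RibetTakahashiSplitManyPrimeValuationProductShimuraDegreeLowerBoundOfPaired
import Summits.ABC.ABC.Theorems.RibetTakahashiSplitManyPrimeValuationProductBootstrap
import Summits.ABC.ABC.Theorems.RibetTakahashiSplitManyPrimeValuationProductCoveringGlue

/-!
# The position of the Shimura degree lower bound (line `jl-zero-cycle-height`, lever of rev c4)

Helper `--supports` stmt-ABC-1561 (crux `Summit.ABC.ABC.Theses.RibetTakahashiSplit.ManyPrimeValuationProduct`,
line `jl-zero-cycle-height`, lead c5).  The line's one open load-bearing stub is the SHIMURA DEGREE LOWER BOUND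
("the lever"): for every globally minimal elliptic `W/ℚ` semistable away from `2`, every covering set `D` of
multiplicative primes (`N = (∏ D)·M`), every Shimura-curve datum `X` of level `(∏ D, M)` and every parametrisation
datum `P` of `W` on `X`, `log deg P ≥ log vol(X.fd) − log covol(Λ_P) − ε log N − C_ε`.

Rev c4 certified "lever ⟸ paired crux" modulo four inputs (`stub_shimuraDegreeLowerBoundOfPaired`, p121504:
Pasten's Thm 6.1 numerator, the optimal quotient, the GHL lower bound, the route item `MazurKenkuRadius`).  This file
composes that with the route's bootstrap file (`RibetTakahashiSplitManyPrimeValuationProductBootstrap`, p81483) and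
records, sorry-free and modulo the SAME four inputs, where the lever sits in the route and under the summit:

* `pairedValuationProduct_le_of_polySzpiro` — ANY polynomial Szpiro bound `|Δ_min| ≤ C N^K` on the curves semistable
  away from `2` gives the paired bound `T_D ≤ C'_ε N^ε` for every covering set (indeed for every set of multiplicative
  primes; no cardinality hypothesis).
* `pairedValuationProduct_le_of_manyPrime_of_fewPrime` — the two valuation-product items of the route together
  (r2 `ManyPrimeValuationProduct`, r4 `FewPrimeValuationProduct`) give the same paired bound (split on the number of odd
  multiplicative primes; `T_D ≤ T`).
* `shimuraDegreeLowerBound_of_polySzpiro`, `…_of_weightedSzpiroBound` (r3′, stmt-ABC-3272), `…_of_szpiro`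
  (`SzpiroConjecture` at `ε = 1`), `…_of_abc` (the summit, through `szpiro_of_abcLe_holds`),
  `…_of_manyPrime_of_fewPrime` (r2 ∧ r4) — the lever follows from each of these modulo the four inputs.

Consequences recorded for the planner (lead c5 cycle report): modulo cited theorems the lever is sandwiched
`ABC ⟹ r3′ ⟹ lever` and `lever ∧ (Fermat input on the class) ⟹ r2` (p121499 + p121801), and `r2 ∧ r4 ⟹ lever`;
so, like the crux itself (Disproof §2), the lever admits no truth-level refutation short of `¬ABC`, and the line
supplies no inequality beyond the reformulation.
-/

-- `Summit.ABC.ABC` is the mandated summit-side namespace (CONVENTIONS §2); the duplicate is deliberate.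
set_option linter.dupNamespace false

open MeasureTheory Finset

namespace Summit.ABC.ABC.Theorems.ManyPrimeValuationProduct

open Summit.ABC.ABC.Theses.RibetTakahashiSplit
open Literature.NumberTheory.EllipticCurves (SzpiroConjecture szpiro_of_abcLe_holds)

/-! ## The paired bound from polynomial Szpiro, and from r2 ∧ r4 -/

/-- **Paired bound from polynomial Szpiro.** If `|Δ_min(E)| ≤ C N_E^K` for every elliptic `E/ℚ` semistable away from
`2`, then for every `ε > 0` there is `C'` with `∏_{p ∈ D} ord_p(Δ_min) ≤ C' N^ε` for every such `E` and every set `D`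
of multiplicative primes (each factor over a multiplicative prime is `≥ 1`, so `T_D ≤ T`, and `T ≤ C' N^ε` by
`valuationProduct_le_of_polySzpiro`). [folklore] -/
theorem pairedValuationProduct_le_of_polySzpiro {K C : ℝ}
    (hS : ∀ (W : WeierstrassCurve ℚ) [W.IsElliptic],
      (∀ p : ℕ, p.Prime → p ≠ 2 → ¬ p ^ 2 ∣ W.conductorNorm ℤ) →
      ((W.minimalDiscriminantNorm ℤ : ℕ) : ℝ) ≤ C * ((W.conductorNorm ℤ : ℕ) : ℝ) ^ K) :
    ∀ ε : ℝ, 0 < ε → ∃ C' : ℝ, ∀ (W : WeierstrassCurve ℚ) [W.IsElliptic],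
      (∀ p : ℕ, p.Prime → p ≠ 2 → ¬ p ^ 2 ∣ W.conductorNorm ℤ) →
      ∀ D : Finset ℕ,
        D ⊆ (W.conductorNorm ℤ).primeFactors.filter (fun p => ¬ p ^ 2 ∣ W.conductorNorm ℤ) →
        ((∏ p ∈ D, (W.minimalDiscriminantNorm ℤ).factorization p : ℕ) : ℝ) ≤
          C' * (W.conductorNorm ℤ : ℝ) ^ ε := by
  intro ε hε
  obtain ⟨C', hC'⟩ := valuationProduct_le_of_polySzpiro
    (P := fun W => ∀ p : ℕ, p.Prime → p ≠ 2 → ¬ p ^ 2 ∣ W.conductorNorm ℤ) (K := K) (C := C)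
    (fun W _ hW => hS W hW) ε hε
  refine ⟨C', fun W _ hss D hD => ?_⟩
  have hle : ∏ p ∈ D, (W.minimalDiscriminantNorm ℤ).factorization p ≤
      ∏ p ∈ (W.conductorNorm ℤ).primeFactors with ¬ p ^ 2 ∣ W.conductorNorm ℤ,
        (W.minimalDiscriminantNorm ℤ).factorization p :=
    Finset.prod_le_prod_of_subset_of_one_le' hD
      (fun p hp _ => one_le_factorization_of_mem_filter W hp)
  calc ((∏ p ∈ D, (W.minimalDiscriminantNorm ℤ).factorization p : ℕ) : ℝ)
      ≤ ((∏ p ∈ (W.conductorNorm ℤ).primeFactors with ¬ p ^ 2 ∣ W.conductorNorm ℤ,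
          (W.minimalDiscriminantNorm ℤ).factorization p : ℕ) : ℝ) := by exact_mod_cast hle
    _ ≤ C' * (W.conductorNorm ℤ : ℝ) ^ ε := hC' W hss

/-- **Paired bound from r2 ∧ r4.** The route's two valuation-product items together — `ManyPrimeValuationProduct`
(`≥ 4` odd multiplicative primes) and `FewPrimeValuationProduct` (`≤ 3`) — bound `T(E) ≤ C_ε N^ε` on every curve
semistable away from `2`, hence `T_D ≤ C_ε N^ε` for every set `D` of multiplicative primes. [folklore] -/
theorem pairedValuationProduct_le_of_manyPrime_of_fewPrime
    (h₂ : ManyPrimeValuationProduct) (h₄ : FewPrimeValuationProduct) :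
    ∀ ε : ℝ, 0 < ε → ∃ C' : ℝ, ∀ (W : WeierstrassCurve ℚ) [W.IsElliptic],
      (∀ p : ℕ, p.Prime → p ≠ 2 → ¬ p ^ 2 ∣ W.conductorNorm ℤ) →
      ∀ D : Finset ℕ,
        D ⊆ (W.conductorNorm ℤ).primeFactors.filter (fun p => ¬ p ^ 2 ∣ W.conductorNorm ℤ) →
        ((∏ p ∈ D, (W.minimalDiscriminantNorm ℤ).factorization p : ℕ) : ℝ) ≤
          C' * (W.conductorNorm ℤ : ℝ) ^ ε := by
  intro ε hε
  obtain ⟨C₂, hC₂⟩ := h₂ ε hε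
  obtain ⟨C₄, hC₄⟩ := h₄ ε hε
  refine ⟨max C₂ C₄, fun W _ hss D hD => ?_⟩
  have hle : ∏ p ∈ D, (W.minimalDiscriminantNorm ℤ).factorization p ≤
      ∏ p ∈ (W.conductorNorm ℤ).primeFactors with ¬ p ^ 2 ∣ W.conductorNorm ℤ,
        (W.minimalDiscriminantNorm ℤ).factorization p :=
    Finset.prod_le_prod_of_subset_of_one_le' hD
      (fun p hp _ => one_le_factorization_of_mem_filter W hp)
  have hN0 : (0 : ℝ) ≤ (W.conductorNorm ℤ : ℝ) ^ ε := Real.rpow_nonneg (Nat.cast_nonneg _) _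
  have hT : ((∏ p ∈ (W.conductorNorm ℤ).primeFactors with ¬ p ^ 2 ∣ W.conductorNorm ℤ,
        (W.minimalDiscriminantNorm ℤ).factorization p : ℕ) : ℝ) ≤
      max C₂ C₄ * (W.conductorNorm ℤ : ℝ) ^ ε := by
    rcases le_or_gt 4
        ((W.conductorNorm ℤ).primeFactors.filter
          (fun p => p ≠ 2 ∧ ¬ p ^ 2 ∣ W.conductorNorm ℤ)).card with h4 | h3
    · exact (hC₂ W hss h4).trans (mul_le_mul_of_nonneg_right (le_max_left _ _) hN0)
    · exact (hC₄ W hss (by omega)).trans (mul_le_mul_of_nonneg_right (le_max_right _ _) hN0)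
  calc ((∏ p ∈ D, (W.minimalDiscriminantNorm ℤ).factorization p : ℕ) : ℝ)
      ≤ ((∏ p ∈ (W.conductorNorm ℤ).primeFactors with ¬ p ^ 2 ∣ W.conductorNorm ℤ,
          (W.minimalDiscriminantNorm ℤ).factorization p : ℕ) : ℝ) := by exact_mod_cast hle
    _ ≤ max C₂ C₄ * (W.conductorNorm ℤ : ℝ) ^ ε := hT

/-! ## The lever from polynomial Szpiro, from r3′, from Szpiro, from `ABC`, from r2 ∧ r4 -/

/-- **The lever from polynomial Szpiro on the class**, modulo Pasten's Thm 6.1 (numerator), the optimal quotient,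
the GHL lower bound and the Mazur–Kenku radius: composition of `pairedValuationProduct_le_of_polySzpiro` with the
landed converse `stub_shimuraDegreeLowerBoundOfPaired` (p121504). [folklore] -/
theorem shimuraDegreeLowerBound_of_polySzpiro
    (h61 : Literature.NumberTheory.Automorphic.PastenShimura2024_thm_6_1)
    (hopt : Literature.NumberTheory.Automorphic.exists_optimal_modularParametrizationData)
    (hGHL : Literature.NumberTheory.EllipticCurves.ModularForms.murty_petersson_newform_lower_bound)
    (hMK : MazurKenkuRadius) {K C : ℝ}
    (hS : ∀ (W : WeierstrassCurve ℚ) [W.IsElliptic],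
      (∀ p : ℕ, p.Prime → p ≠ 2 → ¬ p ^ 2 ∣ W.conductorNorm ℤ) →
      ((W.minimalDiscriminantNorm ℤ : ℕ) : ℝ) ≤ C * ((W.conductorNorm ℤ : ℕ) : ℝ) ^ K) :
    ∀ ε : ℝ, 0 < ε → ∃ C : ℝ, ∀ (W : WeierstrassCurve ℚ) [W.IsElliptic] [W.IsGloballyMinimal],
      (∀ p : ℕ, p.Prime → p ≠ 2 → ¬ p ^ 2 ∣ W.conductorNorm ℤ) →
      ∀ D : Finset ℕ,
        (D ⊆ (W.conductorNorm ℤ).primeFactors.filter (fun p => ¬ p ^ 2 ∣ W.conductorNorm ℤ) ∧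
          Even D.card ∧ 2 ≤ D.card ∧
          2 ≤ ((W.conductorNorm ℤ).primeFactors.filter (fun p => ¬ p ^ 2 ∣ W.conductorNorm ℤ) \
            D).card) →
      ∀ M : ℕ, (∏ p ∈ D, p) * M = W.conductorNorm ℤ →
      ∀ (X : Literature.NumberTheory.Automorphic.ShimuraCurveData (∏ p ∈ D, p) M)
        (P : Literature.NumberTheory.Automorphic.ShimuraParametrizationData X W),
        Real.log (MeasureTheory.volume X.fd).toReal - Real.log (ZLattice.covolume P.L.lattice) -
          (ε * Real.log (W.conductorNorm ℤ) + C) ≤ Real.log (P.deg : ℝ) := by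
  refine stub_shimuraDegreeLowerBoundOfPaired h61 hopt hGHL hMK fun ε hε => ?_
  obtain ⟨C', hC'⟩ := pairedValuationProduct_le_of_polySzpiro hS ε hε
  exact ⟨C', fun W _ hss D hD => hC' W hss D hD.1⟩

/-- **The lever from r3′** (`WeightedSzpiroBound`, stmt-ABC-3272): r3′ alone gives polynomial Szpiro
`|Δ_min| ≤ C N^{14}` on the class (`polySzpiro_of_weightedSzpiroBound`, p81483), hence the lever modulo the four
inputs.  Since `WeightedSzpiroBound ↔ ABC` in the tree, this is the route-internal form of `…_of_abc`. [folklore] -/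
theorem shimuraDegreeLowerBound_of_weightedSzpiroBound :
    Literature.NumberTheory.Automorphic.PastenShimura2024_thm_6_1 →
    Literature.NumberTheory.Automorphic.exists_optimal_modularParametrizationData →
    Literature.NumberTheory.EllipticCurves.ModularForms.murty_petersson_newform_lower_bound →
    Summit.ABC.ABC.Theses.RibetTakahashiSplit.MazurKenkuRadius →
    Summit.ABC.ABC.Theses.RibetTakahashiSplit.WeightedSzpiroBound →
    ∀ ε : ℝ, 0 < ε → ∃ C : ℝ, ∀ (W : WeierstrassCurve ℚ) [W.IsElliptic] [W.IsGloballyMinimal],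
      (∀ p : ℕ, p.Prime → p ≠ 2 → ¬ p ^ 2 ∣ W.conductorNorm ℤ) →
      ∀ D : Finset ℕ,
        (D ⊆ (W.conductorNorm ℤ).primeFactors.filter (fun p => ¬ p ^ 2 ∣ W.conductorNorm ℤ) ∧
          Even D.card ∧ 2 ≤ D.card ∧
          2 ≤ ((W.conductorNorm ℤ).primeFactors.filter (fun p => ¬ p ^ 2 ∣ W.conductorNorm ℤ) \
            D).card) →
      ∀ M : ℕ, (∏ p ∈ D, p) * M = W.conductorNorm ℤ →
      ∀ (X : Literature.NumberTheory.Automorphic.ShimuraCurveData (∏ p ∈ D, p) M)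
        (P : Literature.NumberTheory.Automorphic.ShimuraParametrizationData X W),
        Real.log (MeasureTheory.volume X.fd).toReal - Real.log (ZLattice.covolume P.L.lattice) -
          (ε * Real.log (W.conductorNorm ℤ) + C) ≤ Real.log (P.deg : ℝ) := by
  intro h61 hopt hGHL hMK h₃
  obtain ⟨C, hC⟩ := polySzpiro_of_weightedSzpiroBound h₃
  exact shimuraDegreeLowerBound_of_polySzpiro h61 hopt hGHL hMK (K := 14) (C := C)
    (fun W _ hss => hC W hss)

/-- **The lever from Szpiro's conjecture** (`SzpiroConjecture` at `ε = 1`: `|Δ_min| ≤ C N⁷` for every `E/ℚ`), modulo the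
four inputs. [folklore] -/
theorem shimuraDegreeLowerBound_of_szpiro
    (h61 : Literature.NumberTheory.Automorphic.PastenShimura2024_thm_6_1)
    (hopt : Literature.NumberTheory.Automorphic.exists_optimal_modularParametrizationData)
    (hGHL : Literature.NumberTheory.EllipticCurves.ModularForms.murty_petersson_newform_lower_bound)
    (hMK : MazurKenkuRadius) (hSz : SzpiroConjecture) :
    ∀ ε : ℝ, 0 < ε → ∃ C : ℝ, ∀ (W : WeierstrassCurve ℚ) [W.IsElliptic] [W.IsGloballyMinimal],
      (∀ p : ℕ, p.Prime → p ≠ 2 → ¬ p ^ 2 ∣ W.conductorNorm ℤ) →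
      ∀ D : Finset ℕ,
        (D ⊆ (W.conductorNorm ℤ).primeFactors.filter (fun p => ¬ p ^ 2 ∣ W.conductorNorm ℤ) ∧
          Even D.card ∧ 2 ≤ D.card ∧
          2 ≤ ((W.conductorNorm ℤ).primeFactors.filter (fun p => ¬ p ^ 2 ∣ W.conductorNorm ℤ) \
            D).card) →
      ∀ M : ℕ, (∏ p ∈ D, p) * M = W.conductorNorm ℤ →
      ∀ (X : Literature.NumberTheory.Automorphic.ShimuraCurveData (∏ p ∈ D, p) M)
        (P : Literature.NumberTheory.Automorphic.ShimuraParametrizationData X W),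
        Real.log (MeasureTheory.volume X.fd).toReal - Real.log (ZLattice.covolume P.L.lattice) -
          (ε * Real.log (W.conductorNorm ℤ) + C) ≤ Real.log (P.deg : ℝ) := by
  obtain ⟨C, hC⟩ := hSz 1 one_pos
  exact shimuraDegreeLowerBound_of_polySzpiro h61 hopt hGHL hMK (K := 6 + 1) (C := C)
    (fun W _ _ => hC W)

/-- **The summit implies the lever**: `ABC → SzpiroConjecture` (`szpiro_of_abcLe_holds`, Silverman AEC VIII.11.5(b),
discharged in the tree) and `shimuraDegreeLowerBound_of_szpiro`.  So, modulo the four inputs, the lever — like the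
crux (Disproof §2, `manyPrimeValuationProduct_of_abc`) — admits no truth-level refutation short of `¬ABC`. [folklore] -/
theorem shimuraDegreeLowerBound_of_abc
    (h61 : Literature.NumberTheory.Automorphic.PastenShimura2024_thm_6_1)
    (hopt : Literature.NumberTheory.Automorphic.exists_optimal_modularParametrizationData)
    (hGHL : Literature.NumberTheory.EllipticCurves.ModularForms.murty_petersson_newform_lower_bound)
    (hMK : MazurKenkuRadius) (hA : _root_.ABC) :
    ∀ ε : ℝ, 0 < ε → ∃ C : ℝ, ∀ (W : WeierstrassCurve ℚ) [W.IsElliptic] [W.IsGloballyMinimal],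
      (∀ p : ℕ, p.Prime → p ≠ 2 → ¬ p ^ 2 ∣ W.conductorNorm ℤ) →
      ∀ D : Finset ℕ,
        (D ⊆ (W.conductorNorm ℤ).primeFactors.filter (fun p => ¬ p ^ 2 ∣ W.conductorNorm ℤ) ∧
          Even D.card ∧ 2 ≤ D.card ∧
          2 ≤ ((W.conductorNorm ℤ).primeFactors.filter (fun p => ¬ p ^ 2 ∣ W.conductorNorm ℤ) \
            D).card) →
      ∀ M : ℕ, (∏ p ∈ D, p) * M = W.conductorNorm ℤ →
      ∀ (X : Literature.NumberTheory.Automorphic.ShimuraCurveData (∏ p ∈ D, p) M)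
        (P : Literature.NumberTheory.Automorphic.ShimuraParametrizationData X W),
        Real.log (MeasureTheory.volume X.fd).toReal - Real.log (ZLattice.covolume P.L.lattice) -
          (ε * Real.log (W.conductorNorm ℤ) + C) ≤ Real.log (P.deg : ℝ) := by
  refine shimuraDegreeLowerBound_of_szpiro h61 hopt hGHL hMK (szpiro_of_abcLe_holds fun ε hε => ?_)
  obtain ⟨C, -, hC⟩ := (ABC_iff.mp hA) ε hε
  exact ⟨C, fun a b c habc => (hC a b c habc).le⟩

/-- **The lever from r2 ∧ r4** (`ManyPrimeValuationProduct ∧ FewPrimeValuationProduct`), modulo the four inputs: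
with `lever ∧ (Fermat input on the class) ⟹ r2` (p121499, p121801) this is the kernel-certified sense in which the
lever is the valuation-product conjecture in degree clothing. [folklore] -/
theorem shimuraDegreeLowerBound_of_manyPrime_of_fewPrime
    (h61 : Literature.NumberTheory.Automorphic.PastenShimura2024_thm_6_1)
    (hopt : Literature.NumberTheory.Automorphic.exists_optimal_modularParametrizationData)
    (hGHL : Literature.NumberTheory.EllipticCurves.ModularForms.murty_petersson_newform_lower_bound)
    (hMK : MazurKenkuRadius) (h₂ : ManyPrimeValuationProduct) (h₄ : FewPrimeValuationProduct) :
    ∀ ε : ℝ, 0 < ε → ∃ C : ℝ, ∀ (W : WeierstrassCurve ℚ) [W.IsElliptic] [W.IsGloballyMinimal],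
      (∀ p : ℕ, p.Prime → p ≠ 2 → ¬ p ^ 2 ∣ W.conductorNorm ℤ) →
      ∀ D : Finset ℕ,
        (D ⊆ (W.conductorNorm ℤ).primeFactors.filter (fun p => ¬ p ^ 2 ∣ W.conductorNorm ℤ) ∧
          Even D.card ∧ 2 ≤ D.card ∧
          2 ≤ ((W.conductorNorm ℤ).primeFactors.filter (fun p => ¬ p ^ 2 ∣ W.conductorNorm ℤ) \
            D).card) →
      ∀ M : ℕ, (∏ p ∈ D, p) * M = W.conductorNorm ℤ →
      ∀ (X : Literature.NumberTheory.Automorphic.ShimuraCurveData (∏ p ∈ D, p) M)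
        (P : Literature.NumberTheory.Automorphic.ShimuraParametrizationData X W),
        Real.log (MeasureTheory.volume X.fd).toReal - Real.log (ZLattice.covolume P.L.lattice) -
          (ε * Real.log (W.conductorNorm ℤ) + C) ≤ Real.log (P.deg : ℝ) := by
  refine stub_shimuraDegreeLowerBoundOfPaired h61 hopt hGHL hMK fun ε hε => ?_
  obtain ⟨C', hC'⟩ := pairedValuationProduct_le_of_manyPrime_of_fewPrime h₂ h₄ ε hε
  exact ⟨C', fun W _ hss D hD => hC' W hss D hD.1⟩

end Summit.ABC.ABC.Theorems.ManyPrimeValuationProduct
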